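import Literature.NumberTheory.ConnesMoscovici2022.UVProlateMaxDomainBoundaryBC
import Mathlib.Analysis.SpecialFunctions.Log.NegMulLog

/-!
# RH-FREE. Connes–Moscovici 2022, §1: a-priori behaviour `p·ξ → 0` at `±λ` for EVERY element of
# `dom W_max` (regular representative), from the boundedness of `p·ξ′` there

LINE 1 FRAMING: RH-FREE corpus literature (cell rh-crit, C1 Connes–Consani/Moscovici corpus, row O2
`UVProlateSpectrum`; Sturm–Liouville bookkeeping for `W_λ = −∂ₓ(λ² − x²)∂ₓ + (2πλx)²`).  bears_on:
W-C/W-P only (sequel material, no leaf role).  WHAT THIS IS NOT: nothing here bears on the truth of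
RH; no statement about zeta zeros; theorems only (0 defs, 0 named facts).

## What is proved

For `g ∈ C¹(a, b)` with `‖g′(x)‖ ≤ K/(x − a)` (the shape forced by `p g′ → c` at a zero `a` of `p`):
the log-growth bound `‖g(x)‖ ≤ ‖g(x₁)‖ + K (log(x₁ − a) − log(x − a))`
(`norm_le_of_norm_deriv_le_inv`), hence `p·g → 0` at `a⁺` whenever `‖p(x)‖ ≤ L (x − a)`
(`tendsto_mul_zero_nhdsGT_of_norm_deriv_le_inv`; mirror `…nhdsLT…` at `b⁻`).  Instantiated for the
prolate coefficient `p = λ² − x²` and the regular representative `g` of ANY `ξ ∈ dom W_max`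
(`exists_regular_repr`: `p g′` has one-sided limits at `±λ`):
**`tendsto_pCoeff_mul_zero_four_sides`** — `(λ² − x²) g(x) → 0` at `λ^±` and `(−λ)^±`.  This is the
a-priori input «`p ξ → 0` at `±λ`» of the Green's-formula evaluation of `Ω(ξ, α_±)`, `Ω(ξ, β_±)`
(the boundary functionals (1.18)) for general `ξ ∈ dom W_max`.

Printed source: [ConnesMoscovici2022] = arXiv:2112.05500v1, Lemma 2.2 and its proof (chunk
p0004:L50–L101: `p ∂ₓξ` is a continuous function near `a = ±λ`), and (1.18) (chunk p0006:L9–L24).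
Cell rh-crit seat cc-t6 g4 (offer to seat cc-t10's §3, cc/STATUS 17:23Z).
-/

noncomputable section

open Complex Set MeasureTheory Filter Topology intervalIntegral
open scoped Real Topology

namespace Literature.NumberTheory.ConnesMoscovici2022

open Literature.NumberTheory.ConnesConsani2021 Literature.NumberTheory.ConnesConsani2024

/-! ## Abstract one-sided lemmas -/

section Abstract

variable {a b K L : ℝ} {g p : ℝ → ℂ}

/-- RH-FREE (PROVED). **Log-growth bound.** If `g ∈ C¹(a,b)` and `‖g′(x)‖ ≤ K/(x − a)` on `(a,b)`,
then `‖g(x)‖ ≤ ‖g(x₁)‖ + K (log(x₁ − a) − log(x − a))` for `a < x ≤ x₁ < b`.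
[cite: ConnesMoscovici2022, proof of Lemma 1.2 (= arXiv Lemma 2.2, chunk p0004:L50–L101)] -/
theorem norm_le_of_norm_deriv_le_inv (hg : ContDiffOn ℝ 1 g (Ioo a b))
    (hd : ∀ x ∈ Ioo a b, ‖deriv g x‖ ≤ K * (x - a)⁻¹) {x x₁ : ℝ} (hx : a < x) (hxx₁ : x ≤ x₁)
    (hx₁ : x₁ < b) :
    ‖g x‖ ≤ ‖g x₁‖ + K * (Real.log (x₁ - a) - Real.log (x - a)) := by
  have hgd : ∀ x ∈ Ioo a b, HasDerivAt g (deriv g x) x := fun x hx ↦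
    ((hg.differentiableOn one_ne_zero x hx).differentiableAt (Ioo_mem_nhds hx.1 hx.2)).hasDerivAt
  have hg'c : ContinuousOn (deriv g) (Ioo a b) := hg.continuousOn_deriv_of_isOpen isOpen_Ioo le_rfl
  have hsub : uIcc x x₁ ⊆ Ioo a b := by
    rw [uIcc_of_le hxx₁]; exact fun t ht ↦ ⟨hx.trans_le ht.1, ht.2.trans_lt hx₁⟩
  have hFTC : ∫ t in x..x₁, deriv g t = g x₁ - g x :=
    integral_eq_sub_of_hasDerivAt (fun t ht ↦ hgd t (hsub ht)) ((hg'c.mono hsub).intervalIntegrable)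
  -- the comparison integral `∫_x^{x₁} K/(t − a) dt = K (log(x₁ − a) − log(x − a))`
  have hlogd : ∀ t ∈ uIcc x x₁, HasDerivAt (fun t ↦ K * Real.log (t - a)) (K * (t - a)⁻¹) t := by
    intro t ht
    rw [uIcc_of_le hxx₁] at ht
    have hta : t - a ≠ 0 := by linarith [ht.1]
    have h := ((Real.hasDerivAt_log hta).comp t ((hasDerivAt_id t).sub_const a)).const_mul K
    simpa using h
  have hinvc : ContinuousOn (fun t : ℝ ↦ K * (t - a)⁻¹) (uIcc x x₁) := by
    refine continuousOn_const.mul ((continuousOn_id.sub continuousOn_const).inv₀ ?_)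
    intro t ht
    rw [uIcc_of_le hxx₁] at ht
    show t - a ≠ 0
    exact sub_ne_zero.2 (ne_of_gt (hx.trans_le ht.1))
  have hcomp : ∫ t in x..x₁, K * (t - a)⁻¹ = K * Real.log (x₁ - a) - K * Real.log (x - a) :=
    integral_eq_sub_of_hasDerivAt hlogd hinvc.intervalIntegrable
  have hbound : ‖∫ t in x..x₁, deriv g t‖ ≤ ∫ t in x..x₁, K * (t - a)⁻¹ := by
    refine intervalIntegral.norm_integral_le_of_norm_le hxx₁ (ae_of_all _ fun t ht ↦ ?_)
      hinvc.intervalIntegrable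
    exact hd t ⟨hx.trans ht.1, lt_of_le_of_lt ht.2 hx₁⟩
  have e : g x = g x₁ - ∫ t in x..x₁, deriv g t := by rw [hFTC]; ring
  calc ‖g x‖ = ‖g x₁ - ∫ t in x..x₁, deriv g t‖ := by rw [← e]
    _ ≤ ‖g x₁‖ + ‖∫ t in x..x₁, deriv g t‖ := norm_sub_le _ _
    _ ≤ ‖g x₁‖ + K * (Real.log (x₁ - a) - Real.log (x - a)) := by
        rw [mul_sub, ← hcomp]; exact add_le_add le_rfl hbound

/-- RH-FREE (PROVED). **`p·g → 0` at `a⁺`.** If `g ∈ C¹(a,b)`, `‖g′(x)‖ ≤ K/(x − a)` and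
`‖p(x)‖ ≤ L (x − a)` on `(a,b)`, then `p(x) g(x) → 0` as `x → a⁺` (log growth against a simple zero).
[cite: ConnesMoscovici2022, proof of Lemma 1.2 (= arXiv Lemma 2.2, chunk p0004:L50–L101)] -/
theorem tendsto_mul_zero_nhdsGT_of_norm_deriv_le_inv (hab : a < b) (hg : ContDiffOn ℝ 1 g (Ioo a b))
    (hd : ∀ x ∈ Ioo a b, ‖deriv g x‖ ≤ K * (x - a)⁻¹)
    (hp : ∀ x ∈ Ioo a b, ‖p x‖ ≤ L * (x - a)) :
    Tendsto (fun x ↦ p x * g x) (𝓝[>] a) (𝓝 0) := by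
  set x₁ : ℝ := (a + b) / 2 with hx₁
  have hx₁m : x₁ ∈ Ioo a b := ⟨left_lt_add_div_two.2 hab, add_div_two_lt_right.2 hab⟩
  set M : ℝ := ‖g x₁‖ + K * Real.log (x₁ - a) with hM
  -- the majorant `L (x − a) M + L K · (−(x − a) log (x − a))` tends to `0`
  have hsub0 : Tendsto (fun x : ℝ ↦ x - a) (𝓝 a) (𝓝 0) := by
    simpa using (tendsto_id (x := 𝓝 a)).sub_const a
  have h1 : Tendsto (fun x : ℝ ↦ L * (x - a) * M) (𝓝 a) (𝓝 0) := by
    simpa using (hsub0.const_mul L).mul_const M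
  have h2 : Tendsto (fun x : ℝ ↦ Real.negMulLog (x - a)) (𝓝 a) (𝓝 0) := by
    simpa [Real.negMulLog_zero, Function.comp_def] using (Real.continuous_negMulLog.tendsto 0).comp hsub0
  have hmaj : Tendsto (fun x : ℝ ↦ L * (x - a) * M + L * K * Real.negMulLog (x - a)) (𝓝[>] a)
      (𝓝 0) := by
    have := h1.add (h2.const_mul (L * K))
    simp only [mul_zero, add_zero] at this
    exact this.mono_left nhdsWithin_le_nhds
  refine squeeze_zero_norm' ?_ hmaj
  filter_upwards [Ioo_mem_nhdsGT hx₁m.1] with x hx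
  have hxa : 0 < x - a := sub_pos.2 hx.1
  have hgx := norm_le_of_norm_deriv_le_inv hg hd hx.1 hx.2.le hx₁m.2
  have hpx := hp x ⟨hx.1, hx.2.trans hx₁m.2⟩
  calc ‖p x * g x‖ = ‖p x‖ * ‖g x‖ := norm_mul _ _
    _ ≤ L * (x - a) * (‖g x₁‖ + K * (Real.log (x₁ - a) - Real.log (x - a))) :=
        mul_le_mul hpx hgx (norm_nonneg _) ((norm_nonneg _).trans hpx)
    _ = L * (x - a) * M + L * K * Real.negMulLog (x - a) := by
        simp only [hM, Real.negMulLog]; ring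

/-- RH-FREE (PROVED). Log-growth bound at a right endpoint: `‖g′(x)‖ ≤ K/(b − x)` on `(a,b)` gives
`‖g(x)‖ ≤ ‖g(x₁)‖ + K (log(b − x₁) − log(b − x))` for `a < x₁ ≤ x < b`.
[cite: ConnesMoscovici2022, proof of Lemma 1.2 (= arXiv Lemma 2.2, chunk p0004:L50–L101)] -/
theorem norm_le_of_norm_deriv_le_inv' (hg : ContDiffOn ℝ 1 g (Ioo a b))
    (hd : ∀ x ∈ Ioo a b, ‖deriv g x‖ ≤ K * (b - x)⁻¹) {x x₁ : ℝ} (hx₁ : a < x₁) (hx₁x : x₁ ≤ x)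
    (hx : x < b) :
    ‖g x‖ ≤ ‖g x₁‖ + K * (Real.log (b - x₁) - Real.log (b - x)) := by
  have hgd : ∀ x ∈ Ioo a b, HasDerivAt g (deriv g x) x := fun x hx ↦
    ((hg.differentiableOn one_ne_zero x hx).differentiableAt (Ioo_mem_nhds hx.1 hx.2)).hasDerivAt
  have hg'c : ContinuousOn (deriv g) (Ioo a b) := hg.continuousOn_deriv_of_isOpen isOpen_Ioo le_rfl
  have hsub : uIcc x₁ x ⊆ Ioo a b := by
    rw [uIcc_of_le hx₁x]; exact fun t ht ↦ ⟨hx₁.trans_le ht.1, ht.2.trans_lt hx⟩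
  have hFTC : ∫ t in x₁..x, deriv g t = g x - g x₁ :=
    integral_eq_sub_of_hasDerivAt (fun t ht ↦ hgd t (hsub ht)) ((hg'c.mono hsub).intervalIntegrable)
  have hlogd : ∀ t ∈ uIcc x₁ x,
      HasDerivAt (fun t ↦ -(K * Real.log (b - t))) (K * (b - t)⁻¹) t := by
    intro t ht
    rw [uIcc_of_le hx₁x] at ht
    have htb : b - t ≠ 0 := by linarith [ht.2]
    have h := (((Real.hasDerivAt_log htb).comp t
      ((hasDerivAt_const t b).sub (hasDerivAt_id t))).const_mul K).neg
    simpa [Pi.neg_def] using h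
  have hinvc : ContinuousOn (fun t : ℝ ↦ K * (b - t)⁻¹) (uIcc x₁ x) := by
    refine continuousOn_const.mul ((continuousOn_const.sub continuousOn_id).inv₀ ?_)
    intro t ht
    rw [uIcc_of_le hx₁x] at ht
    show b - t ≠ 0
    exact sub_ne_zero.2 (ne_of_gt (ht.2.trans_lt hx))
  have hcomp : ∫ t in x₁..x, K * (b - t)⁻¹ =
      -(K * Real.log (b - x)) - -(K * Real.log (b - x₁)) :=
    integral_eq_sub_of_hasDerivAt hlogd hinvc.intervalIntegrable
  have hbound : ‖∫ t in x₁..x, deriv g t‖ ≤ ∫ t in x₁..x, K * (b - t)⁻¹ := by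
    refine intervalIntegral.norm_integral_le_of_norm_le hx₁x (ae_of_all _ fun t ht ↦ ?_)
      hinvc.intervalIntegrable
    exact hd t ⟨hx₁.trans ht.1, lt_of_le_of_lt ht.2 hx⟩
  have e : g x = g x₁ + ∫ t in x₁..x, deriv g t := by rw [hFTC]; ring
  calc ‖g x‖ = ‖g x₁ + ∫ t in x₁..x, deriv g t‖ := by rw [← e]
    _ ≤ ‖g x₁‖ + ‖∫ t in x₁..x, deriv g t‖ := norm_add_le _ _
    _ ≤ ‖g x₁‖ + K * (Real.log (b - x₁) - Real.log (b - x)) := by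
        have : ∫ t in x₁..x, K * (b - t)⁻¹ = K * (Real.log (b - x₁) - Real.log (b - x)) := by
          rw [hcomp]; ring
        rw [← this]; exact add_le_add le_rfl hbound

/-- RH-FREE (PROVED). **`p·g → 0` at `b⁻`** (mirror of `tendsto_mul_zero_nhdsGT_of_norm_deriv_le_inv`).
[cite: ConnesMoscovici2022, proof of Lemma 1.2 (= arXiv Lemma 2.2, chunk p0004:L50–L101)] -/
theorem tendsto_mul_zero_nhdsLT_of_norm_deriv_le_inv (hab : a < b) (hg : ContDiffOn ℝ 1 g (Ioo a b))
    (hd : ∀ x ∈ Ioo a b, ‖deriv g x‖ ≤ K * (b - x)⁻¹)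
    (hp : ∀ x ∈ Ioo a b, ‖p x‖ ≤ L * (b - x)) :
    Tendsto (fun x ↦ p x * g x) (𝓝[<] b) (𝓝 0) := by
  set x₁ : ℝ := (a + b) / 2 with hx₁
  have hx₁m : x₁ ∈ Ioo a b := ⟨left_lt_add_div_two.2 hab, add_div_two_lt_right.2 hab⟩
  set M : ℝ := ‖g x₁‖ + K * Real.log (b - x₁) with hM
  have hsub0 : Tendsto (fun x : ℝ ↦ b - x) (𝓝 b) (𝓝 0) := by
    simpa using (tendsto_const_nhds (x := b) (f := 𝓝 b)).sub tendsto_id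
  have h1 : Tendsto (fun x : ℝ ↦ L * (b - x) * M) (𝓝 b) (𝓝 0) := by
    simpa using (hsub0.const_mul L).mul_const M
  have h2 : Tendsto (fun x : ℝ ↦ Real.negMulLog (b - x)) (𝓝 b) (𝓝 0) := by
    simpa [Real.negMulLog_zero, Function.comp_def] using (Real.continuous_negMulLog.tendsto 0).comp hsub0
  have hmaj : Tendsto (fun x : ℝ ↦ L * (b - x) * M + L * K * Real.negMulLog (b - x)) (𝓝[<] b)
      (𝓝 0) := by
    have := h1.add (h2.const_mul (L * K))
    simp only [mul_zero, add_zero] at this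
    exact this.mono_left nhdsWithin_le_nhds
  refine squeeze_zero_norm' ?_ hmaj
  filter_upwards [Ioo_mem_nhdsLT hx₁m.2] with x hx
  have hgx := norm_le_of_norm_deriv_le_inv' hg hd hx₁m.1 hx.1.le hx.2
  have hpx := hp x ⟨hx₁m.1.trans hx.1, hx.2⟩
  calc ‖p x * g x‖ = ‖p x‖ * ‖g x‖ := norm_mul _ _
    _ ≤ L * (b - x) * (‖g x₁‖ + K * (Real.log (b - x₁) - Real.log (b - x))) :=
        mul_le_mul hpx hgx (norm_nonneg _) ((norm_nonneg _).trans hpx)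
    _ = L * (b - x) * M + L * K * Real.negMulLog (b - x) := by
        simp only [hM, Real.negMulLog]; ring

end Abstract

/-! ## The prolate coefficient near its zeros `±λ` -/

section Prolate

variable {lam a : ℝ}

/-- `p = (a − x)(a + x)` for `a = ±λ`. [folklore] -/
private theorem pCoeff_eq_mul (ha : a = lam ∨ a = -lam) (x : ℝ) :
    pCoeff lam x = (((a - x) * (a + x) : ℝ) : ℂ) := by
  rcases ha with rfl | rfl <;> simp [pCoeff] <;> ring

/-- Two-sided comparison of `|p(x)|` with `|x − a|` near `a = ±λ` (`|x − a| < min λ 1`):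
`λ|x − a| ≤ |p(x)| ≤ (2λ + 1)|x − a|`, and `x + a ≠ 0`. [folklore] -/
private theorem norm_pCoeff_near (hlam : 0 < lam) (ha : a = lam ∨ a = -lam) {x : ℝ}
    (hx : |x - a| < min lam 1) :
    lam * |x - a| ≤ ‖pCoeff lam x‖ ∧ ‖pCoeff lam x‖ ≤ (2 * lam + 1) * |x - a| ∧ x + a ≠ 0 := by
  have h2a : |a + a| = 2 * lam := by
    rcases ha with rfl | rfl
    · rw [abs_of_nonneg (by linarith)]; ring
    · rw [abs_of_nonpos (by linarith)]; ring
  have hxl : |x - a| < lam := lt_of_lt_of_le hx (min_le_left _ _)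
  have hx1 : |x - a| < 1 := lt_of_lt_of_le hx (min_le_right _ _)
  -- `|x + a| ≥ 2λ − |x − a|` and `≤ 2λ + |x − a|`
  have hlow : 2 * lam - |x - a| ≤ |x + a| := by
    have := abs_sub_abs_le_abs_sub (a + a) (a - x)
    rw [h2a, show a + a - (a - x) = x + a by ring, abs_sub_comm a x] at this
    linarith
  have hup : |x + a| ≤ 2 * lam + |x - a| := by
    have := abs_add_le (a + a) (x - a)
    rw [h2a, show a + a + (x - a) = x + a by ring] at this
    exact this
  have hnorm : ‖pCoeff lam x‖ = |x - a| * |x + a| := by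
    rw [pCoeff_eq_mul ha, Complex.norm_real, Real.norm_eq_abs, abs_mul, abs_sub_comm a x,
      add_comm a x]
  refine ⟨?_, ?_, ?_⟩
  · rw [hnorm]
    have : lam ≤ |x + a| := by linarith
    calc lam * |x - a| = |x - a| * lam := mul_comm _ _
      _ ≤ |x - a| * |x + a| := mul_le_mul_of_nonneg_left this (abs_nonneg _)
  · rw [hnorm, mul_comm]
    exact mul_le_mul_of_nonneg_right (by linarith) (abs_nonneg _)
  · intro h
    have : |x + a| = 0 := by rw [h, abs_zero]
    linarith

/-- RH-FREE (PROVED). **`(λ² − x²)·ξ(x) → 0` at the four sides of `±λ` for EVERY `ξ ∈ dom W_max`**,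
stated for a representative `g` that is `C¹` off `{±λ}` with `p g′` having one-sided limits at `±λ`
(the output of `exists_regular_repr`): `p g′` is bounded near `a`, so `‖g′‖ ≤ K/|x − a|`, `g` grows
at most logarithmically, and `p` has a simple zero at `a`.
[cite: ConnesMoscovici2022, Lemma 1.2 and (1.18) (= arXiv Lemma 2.2, chunk p0004:L50–L101; (2.18), p0006:L9–L24)] -/
theorem tendsto_pCoeff_mul_zero_four_sides (hlam : 0 < lam) {g : ℝ → ℂ}
    (hg : ContDiffOn ℝ 1 g {x | x ≠ lam ∧ x ≠ -lam})
    (hlim : ∀ a ∈ ({lam, -lam} : Set ℝ),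
      (∃ c, Tendsto (fun x ↦ pCoeff lam x * deriv g x) (𝓝[>] a) (𝓝 c)) ∧
      (∃ c, Tendsto (fun x ↦ pCoeff lam x * deriv g x) (𝓝[<] a) (𝓝 c)))
    (ha : a = lam ∨ a = -lam) :
    Tendsto (fun x ↦ pCoeff lam x * g x) (𝓝[>] a) (𝓝 0) ∧
      Tendsto (fun x ↦ pCoeff lam x * g x) (𝓝[<] a) (𝓝 0) := by
  have ha' : a ∈ ({lam, -lam} : Set ℝ) := by
    rcases ha with rfl | rfl <;> simp
  have hδ : 0 < min lam 1 := lt_min hlam one_pos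
  -- membership in `ℝ ∖ {±λ}` near `a`
  have hU : ∀ x, |x - a| < min lam 1 → x ≠ a → x ∈ {x : ℝ | x ≠ lam ∧ x ≠ -lam} := by
    intro x hx hxa
    have hsum := (norm_pCoeff_near hlam ha hx).2.2
    rcases ha with rfl | rfl
    · exact ⟨hxa, fun h ↦ hsum (by rw [h]; ring)⟩
    · exact ⟨fun h ↦ hsum (by rw [h]; ring), hxa⟩
  -- derivative bound from a bound on `p g′`
  have hderiv : ∀ {C : ℝ} {x : ℝ}, |x - a| < min lam 1 → x ≠ a →
      ‖pCoeff lam x * deriv g x‖ ≤ C → ‖deriv g x‖ ≤ C / lam * |x - a|⁻¹ := by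
    intro C x hx hxa hC
    obtain ⟨hlow, -, -⟩ := norm_pCoeff_near hlam ha hx
    have hxa' : 0 < |x - a| := abs_pos.2 (sub_ne_zero.2 hxa)
    have hp0 : 0 < ‖pCoeff lam x‖ := lt_of_lt_of_le (mul_pos hlam hxa') hlow
    have hC0 : 0 ≤ C := (norm_nonneg _).trans hC
    rw [norm_mul] at hC
    have h1 : ‖deriv g x‖ ≤ C / ‖pCoeff lam x‖ := by
      rw [le_div_iff₀ hp0, mul_comm]; exact hC
    calc ‖deriv g x‖ ≤ C / ‖pCoeff lam x‖ := h1
      _ ≤ C / (lam * |x - a|) := div_le_div_of_nonneg_left hC0 (mul_pos hlam hxa') hlow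
      _ = C / lam * |x - a|⁻¹ := by rw [div_mul_eq_div_div, div_eq_mul_inv]
  constructor
  · -- right side of `a`
    obtain ⟨c, hc⟩ := (hlim a ha').1
    have hev : ∀ᶠ x in 𝓝[>] a, ‖pCoeff lam x * deriv g x‖ ≤ ‖c‖ + 1 :=
      hc.norm.eventually_le_const (lt_add_one _)
    obtain ⟨u, hau, hu⟩ := mem_nhdsGT_iff_exists_Ioo_subset.1 hev
    set b : ℝ := min u (a + min lam 1) with hb
    have hab : a < b := lt_min hau (by linarith)
    have hbu : b ≤ u := min_le_left _ _
    have hbδ : b ≤ a + min lam 1 := min_le_right _ _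
    have habs : ∀ x ∈ Ioo a b, |x - a| < min lam 1 ∧ |x - a| = x - a := fun x hx ↦ by
      rw [abs_of_pos (sub_pos.2 hx.1)]; exact ⟨by linarith [hx.2], rfl⟩
    have hsubU : Ioo a b ⊆ {x : ℝ | x ≠ lam ∧ x ≠ -lam} := fun x hx ↦
      hU x (habs x hx).1 (ne_of_gt hx.1)
    refine tendsto_mul_zero_nhdsGT_of_norm_deriv_le_inv hab (hg.mono hsubU)
      (K := (‖c‖ + 1) / lam) (L := 2 * lam + 1) (fun x hx ↦ ?_) (fun x hx ↦ ?_)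
    · obtain ⟨h1, h2⟩ := habs x hx
      rw [← h2]
      exact hderiv h1 (ne_of_gt hx.1) (hu ⟨hx.1, lt_of_lt_of_le hx.2 hbu⟩)
    · obtain ⟨h1, h2⟩ := habs x hx
      rw [← h2]
      exact (norm_pCoeff_near hlam ha h1).2.1
  · -- left side of `a`
    obtain ⟨c, hc⟩ := (hlim a ha').2
    have hev : ∀ᶠ x in 𝓝[<] a, ‖pCoeff lam x * deriv g x‖ ≤ ‖c‖ + 1 :=
      hc.norm.eventually_le_const (lt_add_one _)
    obtain ⟨l, hla, hl⟩ := mem_nhdsLT_iff_exists_Ioo_subset.1 hev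
    set b : ℝ := max l (a - min lam 1) with hb
    have hba : b < a := max_lt hla (by linarith)
    have hbl : l ≤ b := le_max_left _ _
    have hbδ : a - min lam 1 ≤ b := le_max_right _ _
    have habs : ∀ x ∈ Ioo b a, |x - a| < min lam 1 ∧ |x - a| = a - x := fun x hx ↦ by
      rw [abs_of_neg (sub_neg.2 hx.2)]; exact ⟨by linarith [hx.1], by ring⟩
    have hsubU : Ioo b a ⊆ {x : ℝ | x ≠ lam ∧ x ≠ -lam} := fun x hx ↦
      hU x (habs x hx).1 (ne_of_lt hx.2)
    refine tendsto_mul_zero_nhdsLT_of_norm_deriv_le_inv hba (hg.mono hsubU)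
      (K := (‖c‖ + 1) / lam) (L := 2 * lam + 1) (fun x hx ↦ ?_) (fun x hx ↦ ?_)
    · obtain ⟨h1, h2⟩ := habs x hx
      rw [← h2]
      exact hderiv h1 (ne_of_lt hx.2) (hl ⟨lt_of_le_of_lt hbl hx.1, hx.2⟩)
    · obtain ⟨h1, h2⟩ := habs x hx
      rw [← h2]
      exact (norm_pCoeff_near hlam ha h1).2.1

/-- RH-FREE (PROVED). **Corollary for `dom W_max`:** every `ξ ∈ dom W_max` (`λ > 0`) has a
representative `g`, `C¹` off `{±λ}` (the one of `exists_regular_repr`, with all its clauses), for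
which in addition `(λ² − x²) g(x) → 0` at `λ^±` and `(−λ)^±`.
[cite: ConnesMoscovici2022, Lemma 1.2 (= arXiv Lemma 2.2, chunk p0004:L50–L101)] -/
theorem exists_regular_repr_pCoeff_mul_tendsto_zero (hlam : 0 < lam)
    (ξ : (prolateMax lam).domain) :
    ∃ g : ℝ → ℂ, ((ξ : L2R) : ℝ → ℂ) =ᵐ[volume] g ∧
      ContDiffOn ℝ 1 g {x | x ≠ lam ∧ x ≠ -lam} ∧
      (∀ x y, x ≤ y → Icc x y ⊆ {x | x ≠ lam ∧ x ≠ -lam} →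
        pCoeff lam y * deriv g y - pCoeff lam x * deriv g x =
          ∫ t in x..y, (qCoeff lam t * g t - (prolateMax lam ξ : L2R) t)) ∧
      (∀ a ∈ ({lam, -lam} : Set ℝ),
        (∃ c, Tendsto (fun x ↦ pCoeff lam x * deriv g x) (𝓝[>] a) (𝓝 c)) ∧
        (∃ c, Tendsto (fun x ↦ pCoeff lam x * deriv g x) (𝓝[<] a) (𝓝 c))) ∧
      (∀ a, a = lam ∨ a = -lam →
        Tendsto (fun x ↦ pCoeff lam x * g x) (𝓝[>] a) (𝓝 0) ∧
        Tendsto (fun x ↦ pCoeff lam x * g x) (𝓝[<] a) (𝓝 0)) := by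
  obtain ⟨g, hae, hg, hftc, -, hlim⟩ := exists_regular_repr hlam ξ
  exact ⟨g, hae, hg, hftc, hlim, fun a ha ↦ tendsto_pCoeff_mul_zero_four_sides hlam hg hlim ha⟩

end Prolate

end Literature.NumberTheory.ConnesMoscovici2022
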